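import Literature.NumberTheory.BeurlingPrimes.EulerProduct
import Literature.NumberTheory.LFunctions.VonKochTheorem
import Literature.NumberTheory.LFunctions.VonKochConverse
import Literature.NumberTheory.LFunctions.RHWave0HardyProofs
import Mathlib.NumberTheory.Chebyshev
import HarnessLib

/-!
# The rational primes as a Beurling system: `N = ⌊x⌋`, `ψ_ℙ = ψ`, and `(ℙ, ℕ)` is a `[1/2, 0]`-system under RH

Topic `Literature/NumberTheory/BeurlingPrimes`. Everything in this file is PROVED.

Broucke–Debruyne–Révész (arXiv:2309.01567), §1 p. 3: "the only known examples were conjectural,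
namely the rational primes and integers `(ℙ, ℕ)`, which form a `[1/2, 0]`-system under the Riemann
hypothesis"; §5 p. 14: "throughout this section we will assume the Riemann hypothesis, asserting that
`(ℙ, ℕ)`, the classical primes and integers, are a `[1/2, 0]`-system. On this template system, we
shall consider a few perturbations". This file builds the template:

* `ratPrimes : BeurlingPrimes` — `λ_j = q_j`, the `j`-th rational prime
  (`Literature.NumberTheory.BeurlingPrimes.ratPrime`, `EulerProduct.lean`);
* `genInt_ratPrimes` — its generalized integers are the positive integers
  (`genInt k = encode k`, unique factorisation), so `intCount_ratPrimes : N(x) = ⌊x⌋₊` (`x ≥ 0`);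
* `chebyshevPsi_ratPrimes : ψ_ℙ = Chebyshev.psi`;
* `ratPrimes_primeErrorLE_of_riemannHypothesis` — RH gives `|ψ(x) − x| ≤ C_ε x^{1/2+ε}` on
  `[1, ∞)` (von Koch's theorem, in-tree `vonKoch_chebyshevPsi_of_riemannHypothesis_holds`);
* `not_ratPrimes_primeErrorLE` — `|ψ(x) − x| ≤ C x^γ` on `[1, ∞)` fails for every `γ < 1/2`
  ("as can be seen from the presence of `ζ`-zeros on the line `Re s = 1/2`", BDR p. 14): such a bound
  gives `ζ(s) ≠ 0` for `Re s > max(γ, 1/4)` (in-tree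
  `quasiRiemannHypothesis_of_chebyshevPsi_isBigO_holds`, Montgomery–Vaughan §15.1), contradicting
  Hardy's theorem (in-tree `hardy_infinite_zeros_on_critical_line_holds`);
* `ratPrimes_isSystem_of_riemannHypothesis : RH → ratPrimes.IsSystem (1/2) 0` — the case `β = 0`
  of BDR Theorem 1.3.

## References
* [BrouckeDebruyneRevesz2023] F. Broucke, G. Debruyne, Sz. Gy. Révész, *Some examples of well-behaved
  Beurling number systems*, arXiv:2309.01567 (Trans. AMS 2024), §1 p. 3, §5 p. 14 (read).
* [Hilberdink2005] T. W. Hilberdink, *Well-behaved Beurling primes and integers*, J. Number Theory 112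
  (2005) 332–344, §2.1 (the notion of `[α, β]`-system).
-/

noncomputable section

open Filter Set Asymptotics
open scoped Topology Chebyshev

namespace Literature.NumberTheory.BeurlingPrimes

open Literature.Barriers.RiemannHypothesis Literature.NumberTheory.LFunctions

/-! ### The system -/

/-- **The rational primes as a Beurling generalized prime system**: `λ_j = q_j` (`q₀ = 2`).
[cite: BrouckeDebruyneRevesz2023, §1 p. 3] -/
def ratPrimes : BeurlingPrimes where
  prime j := (ratPrime j : ℝ)
  one_lt := by exact_mod_cast (prime_ratPrime 0).one_lt
  mono i j hij := by
    show (ratPrime i : ℝ) ≤ ratPrime j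
    exact_mod_cast (Nat.nth_strictMono Nat.infinite_setOf_prime).monotone hij
  tendsto_atTop :=
    tendsto_natCast_atTop_atTop.comp (Nat.nth_strictMono Nat.infinite_setOf_prime).tendsto_atTop

/-- The primes of `ratPrimes` are the `q_j`. [folklore] -/
@[simp] theorem ratPrimes_prime (j : ℕ) : ratPrimes.prime j = (ratPrime j : ℝ) := rfl

/-- `j ≤ q_j`. [folklore] -/
theorem le_ratPrime (j : ℕ) : j ≤ ratPrime j :=
  (Nat.nth_strictMono Nat.infinite_setOf_prime).le_apply

/-! ### Generalized integers = positive integers -/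

/-- **Unique factorisation**: the generalized integer with exponent vector `k` is the positive integer
`encode k = ∏_j q_j^{k_j}`. [folklore] -/
theorem genInt_ratPrimes (k : ℕ →₀ ℕ) : ratPrimes.genInt k = (encode k : ℝ) := by
  unfold BeurlingPrimes.genInt encode
  rw [Nat.cast_finsuppProd, Finsupp.prod_mapDomain_index_inj ratPrime_injective]
  simp

/-- The bijection "exponent vectors ≃ positive integers", `k ↦ ∏_j q_j^{k_j}`. [folklore] -/
def encodeEquiv : (ℕ →₀ ℕ) ≃ {n : ℕ // n ≠ 0} :=
  Equiv.ofBijective (fun k ↦ ⟨encode k, encode_ne_zero k⟩)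
    ⟨fun a b h ↦ encode_injective (Subtype.ext_iff.mp h),
     fun n ↦ by obtain ⟨k, hk⟩ := exists_encode_eq n.2; exact ⟨k, Subtype.ext hk⟩⟩

/-- `N_ℙ(x)` counts the positive integers `n ≤ x`. [folklore] -/
theorem intCount_ratPrimes_eq_card (x : ℝ) :
    ratPrimes.intCount x = Nat.card {n : ℕ // n ≠ 0 ∧ (n : ℝ) ≤ x} := by
  unfold BeurlingPrimes.intCount
  have e1 : {k : ℕ →₀ ℕ // ratPrimes.genInt k ≤ x} ≃ {m : {n : ℕ // n ≠ 0} // ((m : ℕ) : ℝ) ≤ x} :=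
    Equiv.subtypeEquiv encodeEquiv fun k ↦ by rw [genInt_ratPrimes]; rfl
  exact Nat.card_congr (e1.trans (Equiv.subtypeSubtypeEquivSubtypeInter (fun n : ℕ ↦ n ≠ 0)
    (fun n : ℕ ↦ (n : ℝ) ≤ x)))

/-- **`N_ℙ(x) = ⌊x⌋`** for `x ≥ 0`. [folklore] -/
theorem intCount_ratPrimes {x : ℝ} (hx : 0 ≤ x) : ratPrimes.intCount x = ⌊x⌋₊ := by
  rw [intCount_ratPrimes_eq_card]
  have e : {n : ℕ // n ≠ 0 ∧ (n : ℝ) ≤ x} ≃ {n : ℕ // n ∈ Finset.Icc 1 ⌊x⌋₊} :=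
    Equiv.subtypeEquivRight fun n ↦ by
      rw [Finset.mem_Icc, Nat.le_floor_iff hx, Nat.one_le_iff_ne_zero]
  rw [Nat.card_congr e, Nat.card_eq_finsetCard, Nat.card_Icc]
  omega

/-! ### `ψ_ℙ = ψ` -/

/-- **`ψ_ℙ(x) = ψ(x)`** (Mathlib's `Chebyshev.psi`): both are `∑_{p^k ≤ x, k ≥ 1} log p`. [folklore] -/
theorem chebyshevPsi_ratPrimes (x : ℝ) : ratPrimes.chebyshevPsi x = ψ x := by
  unfold BeurlingPrimes.chebyshevPsi Chebyshev.psi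
  simp only [ratPrimes_prime]
  set S : Finset (ℕ × ℕ) := Finset.range (⌊x⌋₊ + 1) ×ˢ Finset.range (⌊x⌋₊ + 1) with hS
  -- the condition `q_j^{k+1} ≤ x` in `ℕ`
  have hcond : ∀ j k : ℕ, ((ratPrime j : ℕ) : ℝ) ^ (k + 1) ≤ x ↔ ratPrime j ^ (k + 1) ≤ ⌊x⌋₊ := by
    intro j k
    rw [← Nat.cast_pow]
    constructor
    · intro h; exact Nat.le_floor h
    · intro h
      have hx : 0 ≤ x := by
        by_contra hx
        rw [Nat.floor_of_nonpos (le_of_lt (not_le.mp hx))] at h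
        exact absurd h (not_le.mpr (pow_pos (prime_ratPrime j).pos _))
      exact le_trans (by exact_mod_cast h) (Nat.floor_le hx)
  have hmemS : ∀ j k : ℕ, ratPrime j ^ (k + 1) ≤ ⌊x⌋₊ → (j, k) ∈ S := by
    intro j k h
    have hj : j ≤ ⌊x⌋₊ := le_trans (le_ratPrime j)
      (le_trans (Nat.le_self_pow (Nat.succ_ne_zero k) _) h)
    have hk : k ≤ ⌊x⌋₊ := by
      have h2 : 2 ^ (k + 1) ≤ ratPrime j ^ (k + 1) := Nat.pow_le_pow_left (prime_ratPrime j).two_le _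
      have h3 : k < 2 ^ (k + 1) := lt_trans Nat.lt_two_pow_self (Nat.pow_lt_pow_right (by norm_num) (lt_add_one k))
      omega
    simp only [hS, Finset.mem_product, Finset.mem_range]
    omega
  rw [tsum_eq_sum (s := S) ?_]
  · symm
    refine (Finset.sum_bij_ne_zero (fun jk _ _ ↦ ratPrime jk.1 ^ (jk.2 + 1)) ?_ ?_ ?_ ?_).symm
    · -- lands in `Ioc 0 ⌊x⌋₊`
      intro jk _ hne
      have h : ((ratPrime jk.1 : ℕ) : ℝ) ^ (jk.2 + 1) ≤ x := by by_contra h; exact hne (if_neg h)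
      rw [Finset.mem_Ioc]
      exact ⟨pow_pos (prime_ratPrime _).pos _, (hcond _ _).mp h⟩
    · -- injective
      intro a _ _ b _ _ hab
      obtain ⟨h1, h2⟩ := Nat.Prime.pow_inj (prime_ratPrime _) (prime_ratPrime _) hab
      exact Prod.ext (ratPrime_injective h1) h2
    · -- surjective onto the prime powers
      intro n hn hne
      rw [Finset.mem_Ioc] at hn
      obtain ⟨p, m, hp, hm, rfl⟩ := (isPrimePow_nat_iff n).mp
        (ArithmeticFunction.vonMangoldt_ne_zero_iff.mp hne)
      obtain ⟨k, rfl⟩ : ∃ k, m = k + 1 := ⟨m - 1, by omega⟩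
      refine ⟨(Nat.count Nat.Prime p, k), hmemS _ _ (by rw [ratPrime_count hp]; exact hn.2), ?_, ?_⟩
      · rw [if_pos ((hcond _ _).mpr (by rw [ratPrime_count hp]; exact hn.2)), ratPrime_count hp]
        exact (Real.log_pos (by exact_mod_cast hp.one_lt)).ne'
      · simp only [ratPrime_count hp]
    · -- values agree
      intro jk _ hne
      have h : ((ratPrime jk.1 : ℕ) : ℝ) ^ (jk.2 + 1) ≤ x := by by_contra h; exact hne (if_neg h)
      rw [if_pos h, ArithmeticFunction.vonMangoldt_apply_pow (Nat.succ_ne_zero _),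
        ArithmeticFunction.vonMangoldt_apply_prime (prime_ratPrime _)]
  · intro jk hjk
    rw [if_neg]
    intro h
    exact hjk (hmemS jk.1 jk.2 ((hcond _ _).mp h))

/-! ### What RH and Hardy's theorem say about `(ℙ, ℕ)` -/

/-- From an eventual bound to a bound on `[1, ∞)`: if `f ≥ 0` is non-decreasing and
`f(x) − x = O(x^γ)` (`γ ≥ 0`) then `|f(x) − x| ≤ C x^γ` for all `x ≥ 1`. [folklore] -/
theorem exists_forall_abs_sub_le_of_isBigO {f : ℝ → ℝ} {γ : ℝ} (hγ : 0 ≤ γ) (hf : Monotone f)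
    (hf0 : ∀ x, 0 ≤ f x) (h : (fun x ↦ f x - x) =O[atTop] fun x ↦ x ^ γ) :
    ∃ C : ℝ, ∀ x : ℝ, 1 ≤ x → |f x - x| ≤ C * x ^ γ := by
  obtain ⟨c, hc⟩ := h.bound
  obtain ⟨X₀, hX₀⟩ := hc.exists_forall_of_atTop
  set X := max X₀ 1 with hX
  refine ⟨max c (f X + X), fun x hx ↦ ?_⟩
  have hxγ : 1 ≤ x ^ γ := Real.one_le_rpow hx hγ
  rcases le_or_gt X x with hXx | hxX
  · have h1 := hX₀ x (le_trans (le_max_left _ _) hXx)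
    rw [Real.norm_eq_abs, Real.norm_eq_abs, abs_of_nonneg (le_trans zero_le_one hxγ)] at h1
    exact h1.trans (mul_le_mul_of_nonneg_right (le_max_left _ _) (le_trans zero_le_one hxγ))
  · have h2 : |f x - x| ≤ f X + X := by
      rw [abs_le]
      constructor
      · linarith [hf0 x, hf0 X]
      · linarith [hf hxX.le]
    calc |f x - x| ≤ (f X + X) * 1 := by rw [mul_one]; exact h2
      _ ≤ max c (f X + X) * x ^ γ :=
        mul_le_mul (le_max_right _ _) hxγ zero_le_one (le_trans (by linarith [hf0 X]) (le_max_right _ _))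

/-- **RH half of "`(ℙ, ℕ)` is a `[1/2, 0]`-system"** (von Koch): assuming RH, for every `ε > 0`
there is `C` with `|ψ(x) − x| ≤ C x^{1/2+ε}` for all `x ≥ 1`. [cite: BrouckeDebruyneRevesz2023, §5 p. 14] -/
theorem ratPrimes_primeErrorLE_of_riemannHypothesis (hRH : RiemannHypothesis) {ε : ℝ} (hε : 0 < ε) :
    ratPrimes.PrimeErrorLE (1 / 2 + ε) := by
  have hO := isBigO_rpow_of_isBigO_rpow_half_mul_log_sq
    (vonKoch_chebyshevPsi_of_riemannHypothesis_holds hRH) hε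
  obtain ⟨C, hC⟩ := exists_forall_abs_sub_le_of_isBigO (by linarith) Chebyshev.psi_mono
    Chebyshev.psi_nonneg hO
  exact ⟨C, fun x hx ↦ by rw [chebyshevPsi_ratPrimes]; exact hC x hx⟩

/-- **Unconditional half** ("not for any `ε < 0`", from the zeros of `ζ` on `Re s = 1/2`): for
`γ < 1/2` there is no `C` with `|ψ(x) − x| ≤ C x^γ` for all `x ≥ 1`. Such a bound would give
`ζ(s) ≠ 0` for `Re s > max(γ, 1/4)` (Landau; Montgomery–Vaughan §15.1), contradicting Hardy's
theorem. [cite: BrouckeDebruyneRevesz2023, §5 p. 14] -/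
theorem not_ratPrimes_primeErrorLE {γ : ℝ} (hγ : γ < 1 / 2) : ¬ ratPrimes.PrimeErrorLE γ := by
  rintro ⟨C, hC⟩
  set γ' := max γ (1 / 4) with hγ'
  have hγ'0 : 0 < γ' := lt_of_lt_of_le (by norm_num) (le_max_right _ _)
  have hγ'1 : γ' < 1 / 2 := max_lt hγ (by norm_num)
  have hO : (fun x ↦ ψ x - x) =O[atTop] fun x : ℝ ↦ x ^ γ' := by
    refine IsBigO.of_bound |C| ?_
    filter_upwards [eventually_ge_atTop (1 : ℝ)] with x hx
    have h1 := hC x hx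
    rw [chebyshevPsi_ratPrimes] at h1
    have hx0 : 0 ≤ x ^ γ' := Real.rpow_nonneg (by linarith) _
    rw [Real.norm_eq_abs, Real.norm_eq_abs, abs_of_nonneg hx0]
    calc |ψ x - x| ≤ C * x ^ γ := h1
      _ ≤ |C| * x ^ γ := mul_le_mul_of_nonneg_right (le_abs_self C) (Real.rpow_nonneg (by linarith) _)
      _ ≤ |C| * x ^ γ' :=
        mul_le_mul_of_nonneg_left (Real.rpow_le_rpow_of_exponent_le hx (le_max_left _ _)) (abs_nonneg C)
  have hQ := quasiRiemannHypothesis_of_chebyshevPsi_isBigO_holds γ' hγ'0 hO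
  obtain ⟨t, ht⟩ := hardy_infinite_zeros_on_critical_line_holds.nonempty
  exact hQ _ ht (by simp; linarith) (by simp; norm_num)

/-- The integers of `(ℙ, ℕ)` are `0`-well-behaved: `|⌊x⌋ − x| ≤ 1 ≤ x^ε` (`x ≥ 1`, `ε ≥ 0`). [folklore] -/
theorem ratPrimes_intErrorLE {ε : ℝ} (hε : 0 ≤ ε) : ratPrimes.IntErrorLE 1 ε := by
  refine ⟨1, fun x hx ↦ ?_⟩
  have hx0 : 0 ≤ x := by linarith
  rw [intCount_ratPrimes hx0, one_mul, one_mul]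
  refine le_trans ?_ (Real.one_le_rpow hx hε)
  rw [abs_le]
  constructor <;> linarith [Nat.floor_le hx0, Nat.lt_floor_add_one x]

/-- … and not better: `|⌊x⌋ − x| ≤ C x^ε` on `[1, ∞)` fails for `ε < 0` (test `x = n + 1/2`). [folklore] -/
theorem not_ratPrimes_intErrorLE {ε : ℝ} (hε : ε < 0) : ¬ ratPrimes.IntErrorLE 1 ε := by
  rintro ⟨C, hC⟩
  have ht : Tendsto (fun x : ℝ ↦ C * x ^ ε) atTop (𝓝 0) := by
    have h := (tendsto_rpow_neg_atTop (y := -ε) (by linarith)).const_mul C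
    simpa using h
  obtain ⟨N, hN⟩ := ((ht.eventually (gt_mem_nhds (by norm_num : (0 : ℝ) < 1 / 2)))).exists_forall_of_atTop
  set n : ℕ := ⌈max N 1⌉₊ with hn
  have hn1 : max N 1 ≤ (n : ℝ) := Nat.le_ceil _
  set x : ℝ := n + 1 / 2 with hxdef
  have hx1 : 1 ≤ x := by have := le_max_right N 1; linarith
  have hxN : N ≤ x := by have := le_max_left N 1; linarith
  have hfl : ⌊x⌋₊ = n := by
    rw [Nat.floor_eq_iff (by linarith)]
    constructor <;> linarith
  have h1 := hC x hx1
  rw [intCount_ratPrimes (by linarith), hfl, one_mul] at h1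
  have h2 : |(n : ℝ) - x| = 1 / 2 := by
    rw [hxdef, abs_of_nonpos (by linarith)]; ring
  rw [h2] at h1
  linarith [hN x hxN]

/-- **`(ℙ, ℕ)` is a `[1/2, 0]`-system under RH** (BDR Theorem 1.3, case `β = 0`; p. 14: "assume the
Riemann hypothesis, asserting that `(ℙ, ℕ)` … are a `[1/2, 0]`-system"). [cite: BrouckeDebruyneRevesz2023, Theorem 1.3 (β = 0)] -/
theorem ratPrimes_isSystem_of_riemannHypothesis (hRH : RiemannHypothesis) :
    ratPrimes.IsSystem (1 / 2) 0 := by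
  refine ⟨by norm_num, by norm_num, le_rfl, by norm_num, 1, one_pos, ?_, ?_, ?_, ?_⟩
  · intro ε hε; exact ratPrimes_intErrorLE (by linarith)
  · intro ε hε; exact not_ratPrimes_intErrorLE (by linarith)
  · intro ε hε; exact ratPrimes_primeErrorLE_of_riemannHypothesis hRH hε
  · intro ε hε; exact not_ratPrimes_primeErrorLE (by linarith)

end Literature.NumberTheory.BeurlingPrimes
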